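import Summits.QuantumFields.YangMills.Theorems.BalabanUVNodesN15KingModelComplexLinkGauge
import Summits.QuantumFields.YangMills.Theorems.BalabanUVNodesN15KingModelComplexLinkHolomorphy
import Summits.QuantumFields.YangMills.Theorems.BalabanUVNodesN15KingModelComplexLinkBounds
import Summits.QuantumFields.YangMills.Theorems.BalabanUVNodesN15KingModelComplexLinkSpectrum
import HarnessLib
/-!
# BalabanUVNodes ∕ N15 — THE KING-MODEL RUNG (PART Ϛ-n): THE GAUGE-SATURATED WINDOW — the size that matters is GAUGE-INVARIANT: if SOME complex gauge transform of `(U,V)` lies in the polydisc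
# `‖·‖ ≤ 1+ε`, `2(d+1)cε < m²`, then `M_{U,V}` is invertible, `(U,V) ↦ G` is analytic there and `det M_{U,V}` obeys the window bounds; if the gauge is UNITARY, all block bounds of PARTS Ϛ-b∕Ϛ-c
# hold for `G_{U,V}` itself
# (Track A, DAG node N15 = NE2; FAN-OUT v1.1 §N15 s3 «KING-MODEL RUNG … + what the curved case adds»; count-neutral)
HONEST FRAMING.  Count-neutral (cell `pub-ymgap`, seat `pub-ymgap-dag-n15-e` g43; `--supports stmt-QuantumFields-27247 --as helper` = K3ᴬ, KEY MAP v3).  One finite torus at fixed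
spacing; King's `A = 0` model, FINE covariance layer only; nothing of Bałaban's (3.42) ∕ Thm 3.4 for `G(U)` asserted; nothing continuum ∕ ℝ⁴ ∕ OS ∕ Clay; NOT a node discharge.
WHAT IS DECIDED.  [Balaban1985BackgroundPropagators] states its regularity ∕ smallness conditions (3.35)–(3.37) pp.396–397 on GAUGE-COVARIANT quantities and notes (p.398 l.19) the gauge
invariance of the construction.  PART Ϛ-d showed the polydisc `‖U(b)‖,‖V(b)‖ ≤ 1+ε` is the sharp GAUGE-BLIND window and PART Ϛ-h that the invertibility locus is the union of its complex gauge
orbits' worth more.  This file records the invariant form: with `g : T → GL(n,𝕜)` pointwise invertible and `(g·U, g·V)` the action of Ϛ-h,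
* §1 ★★ **`isUnit_cxLapF_of_gauge_window`** — `(g·U, g·V)` in the window ⟹ `M_{U,V}` invertible; ★★ `analyticAt_cxLapF_inv_of_gauge_window` (Ϛ-e at `(U,V)`); ★ `det_cxLapF_eq_of_gauge` and, over
  ℂ, ★★ `pow_le_norm_det_cxLapF_of_gauge_window` ∕ `norm_det_cxLapF_le_pow_of_gauge_window` (Ϛ-g's determinant window transported along the orbit — the complex Gaussian normalisation
  depends on the gauge class only);
* §2 UNITARY gauges: `blk_cxLapF_inv_eq_unitary_conj` (`(G_{U,V})_{xy} = g(x)^*(G_{g·U,g·V})_{xy}g(y)`), ★★★ **`l2_opNorm_blk_cxLapF_inv_le_of_unitary_gauge_window`** — if a UNITARY gauge transform of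
  `(U,V)` lies in the window then `‖(G_{U,V})_{xy}‖_{op} ≤ (lapF K ((1+ε)c) (m²−2(d+1)cε))⁻¹(x,y)` for `(U,V)` ITSELF (the block norms are unitarily invariant), whence ★★ the mass bound and ★★
  the exponential decay for `G_{U,V}` (`…_le_inv_mass_of_unitary_gauge_window`, `…_le_exp_tdistT_of_unitary_gauge_window`).
So every conclusion of PART Ϛ holds under the weaker, gauge-invariant hypothesis «distance of the gauge ORBIT of `(U,V)` to the flat pair `(1,1)` at most `ε`» (unitary orbit for the
kernel bounds, complex orbit for invertibility ∕ analyticity ∕ determinant).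
PRIOR TREE ART (by name): Ϛ-h (`cxGaugeFwd`, `cxGaugeBwd`, `isUnit_cxLapF_gauge_iff`, `det_cxLapF_gauge`, `blk_cxLapF_inv_gauge`, `cxGaugeFwd_of_unitary`), Ϛ-b (`isUnit_cxLapF`,
`l2_opNorm_blk_cxLapF_inv_le`), Ϛ-c (`l2_opNorm_blk_cxLapF_inv_le_inv_mass`, `…_le_exp_tdistT`), Ϛ-e (`analyticAt_cxLapF_inv`, `CxLinks`), Ϛ-g (`pow_le_norm_det_cxLapF`, `norm_det_cxLapF_le_pow`),
Mathlib (`CStarRing.norm_mem_unitary_mul`, `Matrix.inv_eq_left_inv`).  Dedup (rg at filing): basename 0 files; needles `gauge_window|unitary_conj\\b` 0 tree files.  Locators: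
[Balaban1985BackgroundPropagators] (3.35)–(3.37) pp.396–397, p.398 l.19, Thm 3.4 p.400; [King1986] (4.4) p.670.  0 `sorry`, 0 `def`.
-/

noncomputable section
open scoped BigOperators ComplexConjugate ComplexOrder Matrix.Norms.L2Operator
open Finset Matrix

namespace Summit.QuantumFields.YangMills.BalabanUVNodes.N15KingModelRung.Covariant

open Literature.MathematicalPhysics.QuantumFieldTheory.LatticeDiamagneticInequality (Hopping blk)
open Literature.MathematicalPhysics.QuantumFieldTheory.Balaban1983to89.B5Prop11Plancherel (Tor unitVec)
open Literature.MathematicalPhysics.QuantumFieldTheory.Balaban1983to89.B4TorusKernel (periodConst)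
open Literature.MathematicalPhysics.QuantumFieldTheory.King1986.Torus (lapF tdistT)
open Summit.QuantumFields.YangMills.BalabanUVNodes.N15KingModelRung.TorusSpectral (kappaFree)

variable {d : ℕ} (K : Fin (d + 1) → ℕ) [hK : ∀ μ, NeZero (K μ)]
variable {𝕜 : Type*} [RCLike 𝕜] {n : Type*} [Fintype n] [DecidableEq n] {c m2 ε : ℝ}

/-! ## §1 Complex gauges: invertibility, analyticity, determinant -/

/-- ★★ **INVERTIBILITY UNDER THE GAUGE-SATURATED WINDOW**: if some pointwise-invertible `g` puts `(g·U, g·V)` in the polydisc of radius `1+ε` (`2(d+1)cε < m²`), then `M_{U,V}` is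
invertible. [cite: Balaban1985BackgroundPropagators, p.398 l.19, Thm 3.4 p.400] -/
theorem isUnit_cxLapF_of_gauge_window (hc : 0 ≤ c) (hm : 0 < m2) (hε : 0 ≤ ε) (hwin : 2 * ((d : ℝ) + 1) * c * ε < m2)
    {g : Tor K → Matrix n n 𝕜} (hg : ∀ x, IsUnit (g x)) {U V : Tor K × Fin (d + 1) → Matrix n n 𝕜}
    (hU : ∀ b, ‖cxGaugeFwd K g U b‖ ≤ 1 + ε) (hV : ∀ b, ‖cxGaugeBwd K g V b‖ ≤ 1 + ε) : IsUnit (cxLapF K c m2 U V) :=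
  (isUnit_cxLapF_gauge_iff K c m2 hg U V).mp (isUnit_cxLapF K hc hm hε hwin hU hV)

/-- ★★ **ANALYTICITY UNDER THE GAUGE-SATURATED WINDOW**: then `(U,V) ↦ G` is analytic at `(U,V)`. [cite: Balaban1985BackgroundPropagators, Thm 3.4 p.400, p.398 l.19] -/
theorem analyticAt_cxLapF_inv_of_gauge_window (hc : 0 ≤ c) (hm : 0 < m2) (hε : 0 ≤ ε) (hwin : 2 * ((d : ℝ) + 1) * c * ε < m2)
    {g : Tor K → Matrix n n 𝕜} (hg : ∀ x, IsUnit (g x)) {U V : Tor K × Fin (d + 1) → Matrix n n 𝕜}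
    (hU : ∀ b, ‖cxGaugeFwd K g U b‖ ≤ 1 + ε) (hV : ∀ b, ‖cxGaugeBwd K g V b‖ ≤ 1 + ε) :
    AnalyticAt 𝕜 (fun UV : CxLinks K 𝕜 n => (cxLapF K c m2 UV.1 UV.2)⁻¹) (U, V) :=
  analyticAt_cxLapF_inv K (UV₀ := ((U, V) : CxLinks K 𝕜 n)) (isUnit_cxLapF_of_gauge_window K hc hm hε hwin hg hU hV)

/-- ★ THE DETERMINANT DEPENDS ON THE GAUGE CLASS ONLY: `det M_{U,V} = det M_{g·U,g·V}`. [cite: Balaban1985BackgroundPropagators, p.398 l.19] -/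
theorem det_cxLapF_eq_of_gauge (c m2 : ℝ) {g : Tor K → Matrix n n 𝕜} (hg : ∀ x, IsUnit (g x)) (U V : Tor K × Fin (d + 1) → Matrix n n 𝕜) :
    (cxLapF K c m2 U V).det = (cxLapF K c m2 (cxGaugeFwd K g U) (cxGaugeBwd K g V)).det :=
  (det_cxLapF_gauge K c m2 hg U V).symm

/-- ★★ THE DETERMINANT WINDOW UNDER THE GAUGE-SATURATED HYPOTHESIS (ℂ, lower half): `(m² − 2(d+1)cε)^{|T×ν|} ≤ ‖det M_{U,V}‖`.
[cite: Balaban1985BackgroundPropagators, Thm 3.4 p.400, p.398 l.19] -/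
theorem pow_le_norm_det_cxLapF_of_gauge_window {ν : Type*} [Fintype ν] [DecidableEq ν] (hc : 0 ≤ c) (hε : 0 ≤ ε) (hwin : 2 * ((d : ℝ) + 1) * c * ε < m2)
    {g : Tor K → Matrix ν ν ℂ} (hg : ∀ x, IsUnit (g x)) {U V : Tor K × Fin (d + 1) → Matrix ν ν ℂ}
    (hU : ∀ b, ‖cxGaugeFwd K g U b‖ ≤ 1 + ε) (hV : ∀ b, ‖cxGaugeBwd K g V b‖ ≤ 1 + ε) :
    (m2 - 2 * ((d : ℝ) + 1) * c * ε) ^ Fintype.card (Tor K × ν) ≤ ‖(cxLapF K c m2 U V).det‖ := by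
  rw [det_cxLapF_eq_of_gauge K c m2 hg]
  exact pow_le_norm_det_cxLapF K hc hε hwin hU hV

/-- ★★ … (upper half): `‖det M_{U,V}‖ ≤ (m² + 2(d+1)c(2+ε))^{|T×ν|}`. [cite: Balaban1985BackgroundPropagators, Thm 3.4 p.400, p.398 l.19] -/
theorem norm_det_cxLapF_le_pow_of_gauge_window {ν : Type*} [Fintype ν] [DecidableEq ν] (hc : 0 ≤ c) (hm : 0 < m2) (hε : 0 ≤ ε)
    {g : Tor K → Matrix ν ν ℂ} (hg : ∀ x, IsUnit (g x)) {U V : Tor K × Fin (d + 1) → Matrix ν ν ℂ}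
    (hU : ∀ b, ‖cxGaugeFwd K g U b‖ ≤ 1 + ε) (hV : ∀ b, ‖cxGaugeBwd K g V b‖ ≤ 1 + ε) :
    ‖(cxLapF K c m2 U V).det‖ ≤ (m2 + 2 * ((d : ℝ) + 1) * c * (2 + ε)) ^ Fintype.card (Tor K × ν) := by
  rw [det_cxLapF_eq_of_gauge K c m2 hg]
  exact norm_det_cxLapF_le_pow K hc hm hε hU hV

/-! ## §2 Unitary gauges: the kernel bounds for `G_{U,V}` itself -/

omit hK in
/-- Pointwise-unitary gauge fields are pointwise invertible. [folklore] -/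
theorem isUnit_of_mem_unitaryGroup {g : Tor K → Matrix n n 𝕜} (hg : ∀ x, g x ∈ Matrix.unitaryGroup n 𝕜) (x : Tor K) : IsUnit (g x) := by
  have h : (g x)ᴴ * g x = 1 := by simpa only [star_eq_conjTranspose] using Matrix.mem_unitaryGroup_iff'.mp (hg x)
  exact IsUnit.of_mul_eq_one _ (mul_eq_one_comm.mp h)

/-- `(G_{U,V})_{xy} = g(x)^*·(G_{g·U,g·V})_{xy}·g(y)` for a unitary gauge `g`. [cite: Balaban1985BackgroundPropagators, p.398 l.19] -/
theorem blk_cxLapF_inv_eq_unitary_conj (c m2 : ℝ) {g : Tor K → Matrix n n 𝕜} (hg : ∀ x, g x ∈ Matrix.unitaryGroup n 𝕜) (U V : Tor K × Fin (d + 1) → Matrix n n 𝕜)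
    (x y : Tor K) :
    blk (cxLapF K c m2 U V)⁻¹ x y = (g x)ᴴ * blk (cxLapF K c m2 (cxGaugeFwd K g U) (cxGaugeBwd K g V))⁻¹ x y * g y := by
  have hgu : ∀ z, IsUnit (g z) := isUnit_of_mem_unitaryGroup K hg
  have hxinv : (g x)ᴴ * g x = 1 := by simpa only [star_eq_conjTranspose] using Matrix.mem_unitaryGroup_iff'.mp (hg x)
  have hyinv : (g y)⁻¹ * g y = 1 := Matrix.nonsing_inv_mul _ ((Matrix.isUnit_iff_isUnit_det _).mp (hgu y))
  rw [blk_cxLapF_inv_gauge K c m2 hgu]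
  calc blk (cxLapF K c m2 U V)⁻¹ x y
      = ((g x)ᴴ * g x) * blk (cxLapF K c m2 U V)⁻¹ x y * ((g y)⁻¹ * g y) := by rw [hxinv, hyinv, Matrix.one_mul, Matrix.mul_one]
    _ = (g x)ᴴ * (g x * blk (cxLapF K c m2 U V)⁻¹ x y * (g y)⁻¹) * g y := by simp only [Matrix.mul_assoc]

/-- ★★★ **THE KERNEL BOUND UNDER THE UNITARY GAUGE-SATURATED WINDOW**: if a UNITARY gauge transform of `(U,V)` lies in the polydisc of radius `1+ε` (`2(d+1)cε < m²`) then
`‖(G_{U,V})_{xy}‖_{op} ≤ (lapF K ((1+ε)c) (m²−2(d+1)cε))⁻¹(x,y)` for `(U,V)` ITSELF — the domination depends only on the distance of the unitary gauge ORBIT from the flat pair.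
[cite: Balaban1985BackgroundPropagators, Thm 3.4 p.400, (3.42) p.397, p.398 l.19; King1986, (4.4) p.670] -/
theorem l2_opNorm_blk_cxLapF_inv_le_of_unitary_gauge_window (hc : 0 ≤ c) (hm : 0 < m2) (hε : 0 ≤ ε) (hwin : 2 * ((d : ℝ) + 1) * c * ε < m2)
    {g : Tor K → Matrix n n 𝕜} (hg : ∀ x, g x ∈ Matrix.unitaryGroup n 𝕜) {U V : Tor K × Fin (d + 1) → Matrix n n 𝕜}
    (hU : ∀ b, ‖cxGaugeFwd K g U b‖ ≤ 1 + ε) (hV : ∀ b, ‖cxGaugeBwd K g V b‖ ≤ 1 + ε) (x y : Tor K) :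
    ‖blk (cxLapF K c m2 U V)⁻¹ x y‖ ≤ (lapF K ((1 + ε) * c) (m2 - 2 * ((d : ℝ) + 1) * c * ε))⁻¹ x y := by
  rw [blk_cxLapF_inv_eq_unitary_conj K c m2 hg U V x y, CStarRing.norm_mul_mem_unitary _ (hg y), CStarRing.norm_mem_unitary_mul]
  · exact l2_opNorm_blk_cxLapF_inv_le K hc hm hε hwin hU hV x y
  · simpa only [star_eq_conjTranspose] using Unitary.star_mem (hg x)

/-- ★★ **THE MASS BOUND UNDER THE UNITARY GAUGE-SATURATED WINDOW**: `‖(G_{U,V})_{xy}‖_{op} ≤ 1∕(m² − 2(d+1)cε)`. [cite: Balaban1985BackgroundPropagators, Thm 3.4 p.400, (3.39) p.397] -/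
theorem l2_opNorm_blk_cxLapF_inv_le_inv_mass_of_unitary_gauge_window (hc : 0 ≤ c) (hm : 0 < m2) (hε : 0 ≤ ε) (hwin : 2 * ((d : ℝ) + 1) * c * ε < m2)
    {g : Tor K → Matrix n n 𝕜} (hg : ∀ x, g x ∈ Matrix.unitaryGroup n 𝕜) {U V : Tor K × Fin (d + 1) → Matrix n n 𝕜}
    (hU : ∀ b, ‖cxGaugeFwd K g U b‖ ≤ 1 + ε) (hV : ∀ b, ‖cxGaugeBwd K g V b‖ ≤ 1 + ε) (x y : Tor K) :
    ‖blk (cxLapF K c m2 U V)⁻¹ x y‖ ≤ (m2 - 2 * ((d : ℝ) + 1) * c * ε)⁻¹ := by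
  rw [blk_cxLapF_inv_eq_unitary_conj K c m2 hg U V x y, CStarRing.norm_mul_mem_unitary _ (hg y), CStarRing.norm_mem_unitary_mul]
  · exact l2_opNorm_blk_cxLapF_inv_le_inv_mass K hc hm hε hwin hU hV x y
  · simpa only [star_eq_conjTranspose] using Unitary.star_mem (hg x)

/-- ★★ **THE DECAY UNDER THE UNITARY GAUGE-SATURATED WINDOW**: `‖(G_{U,V})_{xy}‖_{op} ≤ (2∕m′²)·periodConst κ′_F d·e^{−(κ′_F∕(d+1))·tdistT K x y}` with the shifted constants of PART Ϛ-c.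
[cite: Balaban1985BackgroundPropagators, Thm 3.4 p.400, (3.42) p.397; King1986, (4.38) p.674] -/
theorem l2_opNorm_blk_cxLapF_inv_le_exp_tdistT_of_unitary_gauge_window (hc : 0 ≤ c) (hm : 0 < m2) (hε : 0 ≤ ε) (hwin : 2 * ((d : ℝ) + 1) * c * ε < m2)
    {g : Tor K → Matrix n n 𝕜} (hg : ∀ x, g x ∈ Matrix.unitaryGroup n 𝕜) {U V : Tor K × Fin (d + 1) → Matrix n n 𝕜}
    (hU : ∀ b, ‖cxGaugeFwd K g U b‖ ≤ 1 + ε) (hV : ∀ b, ‖cxGaugeBwd K g V b‖ ≤ 1 + ε) (x y : Tor K) :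
    ‖blk (cxLapF K c m2 U V)⁻¹ x y‖
      ≤ 2 / (m2 - 2 * ((d : ℝ) + 1) * c * ε) * periodConst (kappaFree ((1 + ε) * c) (m2 - 2 * ((d : ℝ) + 1) * c * ε) d) d
          * Real.exp (-(kappaFree ((1 + ε) * c) (m2 - 2 * ((d : ℝ) + 1) * c * ε) d / (d + 1) * tdistT K x y)) := by
  rw [blk_cxLapF_inv_eq_unitary_conj K c m2 hg U V x y, CStarRing.norm_mul_mem_unitary _ (hg y), CStarRing.norm_mem_unitary_mul]
  · exact l2_opNorm_blk_cxLapF_inv_le_exp_tdistT K hc hm hε hwin hU hV x y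
  · simpa only [star_eq_conjTranspose] using Unitary.star_mem (hg x)

end Summit.QuantumFields.YangMills.BalabanUVNodes.N15KingModelRung.Covariant

end
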